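import Literature.NumberTheory.Sieve.HeathBrownWeightFourthMoment
import Literature.NumberTheory.Sieve.TernaryHolderCounting
import Literature.NumberTheory.Sieve.RoughModelFourierApprox
import Literature.NumberTheory.Sieve.RoughModelPairCorrelation
import Literature.NumberTheory.LFunctions.MertensElementary
import Mathlib.NumberTheory.Chebyshev
import HarnessLib

/-!
# The Fourier side of `n = p + (x³ + 2y³)`: Parseval, the majorant bound, and the comparison, PROVED

Topic `Literature/NumberTheory/Sieve`, namespace `Literature.NumberTheory.Sieve.CubicMinorant`
(continuation of `HeathBrownWeightFourthMoment.lean`, `TernaryHolderCounting.lean`,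
`RoughModelFourierApprox.lean`, `RoughModelPairCorrelation.lean`).

The Fourier-side comparison of the parity-ideate route `GoldbachHeathBrownDispersion` (support item
«FourierSideComparison», here `fourierSideComparison`, VERBATIM) bounds
`∑_{N<n≤2N} (∑_{k≤N} f₃(k) (θ𝟙_ℙ − g_z)(n−k))² ≤ C N³ (log N)^{−A}` for Heath-Brown's weight `f₃`
and the rough model `g_z` at `2N`, `z = (log 2N)^B`, `B = B(c, A)`.  The proof is the standard
circle-method bookkeeping [Vaughan1997, §3.1–§3.2; Montgomery1994, Ch. 7 §3; MontgomeryVaughan1975, §7]: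
* `expSumOf_mul`, `sum_conv_sq_eq_integral` — Parseval for the product of two generating functions
  (the additive convolution written out as a sum over `k + m = n`), `∑_n (f ∗ g)(n)² = ∫₀¹ |f̂|²|ĝ|²`;
* `sum_conv_sq_le` — the majorant bound `∑_n (f ∗ g)(n)² ≤ ½(λ² ∫|f̂|⁴ + λ⁻² ‖ĝ‖_∞² ∑ g²)` (any `λ > 0`);
* `sum_Icc_mul_eq_conv`, `sum_Ioc_sq_le` — the route's double sum is a partial sum of squares of
  the additive convolution;
* `norm_expSumOf_thetaWeight_sub_le` — `‖(θ𝟙_ℙ − g_z)^‖ ≤ ‖Ŝ_Λ − ĝ_z‖ + (ψ(2N) − θ(2N))`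
  (Mathlib's Chebyshev functions), so the tree's `roughModelFourierApprox_holds` applies;
* `sum_sq_thetaWeight_sub_le` — `∑_{m≤2N} (θ𝟙_ℙ − g_z)(m)² ≪ N log²N + N·P/φ(P) + z⁵` (pair
  correlation of `g_z` at `h = 0`, `exists_pairCorrelation_bound`), with
  `primesProdBelow_div_totient_le_exp_mul_log` — `P(z)/φ(P(z)) ≤ e⁵ log z` (elementary Mertens,
  `MertensElementary`) making the exponent of `log` independent of `B`;
* `fourierSideComparison` — the assembly with `λ² = (log N)^{−A−C₄}`, `A' = A + |C₄| + 2`, the tree's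
  `L⁴` bound `hbFourierFourthMoment_holds` and `roughModelFourierApprox_holds`.

No new facts.  Written for the parity-ideate cell (literature seat g14, 2026-08-27).

## References

* [Vaughan1997] R. C. Vaughan, *The Hardy–Littlewood Method*, 2nd ed., §3.1–§3.2.
* [Montgomery1994] H. L. Montgomery, *Ten Lectures on the Interface between Analytic Number Theory
  and Harmonic Analysis*, Chapter 7 §3 (the majorant principle).
* [MontgomeryVaughan1975] H. L. Montgomery, R. C. Vaughan, *The exceptional set in Goldbach's
  problem*, Acta Arith. 27 (1975), §7.
* [HalberstamRichert1974] H. Halberstam, H.-E. Richert, *Sieve Methods*, Thm 2.5.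
* [HardyWright2008] G. H. Hardy, E. M. Wright, *An Introduction to the Theory of Numbers*, 6th ed.,
  Thm 429 (§22.8).
-/

noncomputable section

open scoped FourierTransform ArithmeticFunction Chebyshev
open Finset MeasureTheory ArithmeticFunction
open Literature.NumberTheory.Sieve

namespace Literature.NumberTheory.Sieve.CubicMinorant

/-! ### The two-sequence additive convolution and the product of exponential sums -/

/-- `f̂(α) ĝ(α) = (f ∗ g)^(α)`. [cite: Montgomery1994, Chapter 7 §3 (the majorant principle for even moments of exponential sums)] -/
theorem expSumOf_mul (f g : ℕ → ℝ) (N M : ℕ) (α : ℝ) :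
    expSumOf f N α * expSumOf g M α =
      expSumOf (fun n : ℕ => ∑ p ∈ (range (N + 1) ×ˢ range (M + 1)).filter (fun p : ℕ × ℕ => p.1 + p.2 = n), f p.1 * g p.2) (N + M) α := by
  have hmul : ∀ p : ℕ × ℕ, ((f p.1 : ℂ) * (𝐞 ((p.1 : ℝ) * α) : ℂ)) *
      ((g p.2 : ℂ) * (𝐞 ((p.2 : ℝ) * α) : ℂ)) =
      ((f p.1 * g p.2 : ℝ) : ℂ) * (𝐞 (((p.1 + p.2 : ℕ) : ℝ) * α) : ℂ) := by
    intro p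
    have h : (𝐞 ((p.1 : ℝ) * α) : ℂ) * (𝐞 ((p.2 : ℝ) * α) : ℂ) =
        (𝐞 (((p.1 + p.2 : ℕ) : ℝ) * α) : ℂ) := by
      rw [← Circle.coe_mul, ← AddChar.map_add_eq_mul]; congr 2; push_cast; ring
    rw [← h]; push_cast; ring
  have hF : ∀ n ∈ range (N + M + 1), ∀ p ∈ (range (N + 1) ×ˢ range (M + 1)).filter
      (fun p : ℕ × ℕ => p.1 + p.2 = n),
      ((f p.1 * g p.2 : ℝ) : ℂ) * (𝐞 ((n : ℝ) * α) : ℂ) =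
        ((f p.1 * g p.2 : ℝ) : ℂ) * (𝐞 (((p.1 + p.2 : ℕ) : ℝ) * α) : ℂ) := by
    intro n _ p hp
    rw [(Finset.mem_filter.1 hp).2]
  have hmaps : ∀ p ∈ range (N + 1) ×ˢ range (M + 1), p.1 + p.2 ∈ range (N + M + 1) := by
    intro p hp
    rw [Finset.mem_product, mem_range, mem_range] at hp
    rw [mem_range]; omega
  calc expSumOf f N α * expSumOf g M α
      = ∑ p ∈ range (N + 1) ×ˢ range (M + 1),
          ((f p.1 : ℂ) * (𝐞 ((p.1 : ℝ) * α) : ℂ)) * ((g p.2 : ℂ) * (𝐞 ((p.2 : ℝ) * α) : ℂ)) := by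
        rw [expSumOf, expSumOf, Finset.sum_mul_sum, ← Finset.sum_product']
    _ = ∑ p ∈ range (N + 1) ×ˢ range (M + 1),
          ((f p.1 * g p.2 : ℝ) : ℂ) * (𝐞 (((p.1 + p.2 : ℕ) : ℝ) * α) : ℂ) :=
        Finset.sum_congr rfl fun p _ => hmul p
    _ = ∑ n ∈ range (N + M + 1), ∑ p ∈ (range (N + 1) ×ˢ range (M + 1)).filter
          (fun p : ℕ × ℕ => p.1 + p.2 = n),
          ((f p.1 * g p.2 : ℝ) : ℂ) * (𝐞 (((p.1 + p.2 : ℕ) : ℝ) * α) : ℂ) :=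
        (Finset.sum_fiberwise_of_maps_to hmaps _).symm
    _ = ∑ n ∈ range (N + M + 1), ∑ p ∈ (range (N + 1) ×ˢ range (M + 1)).filter
          (fun p : ℕ × ℕ => p.1 + p.2 = n),
          ((f p.1 * g p.2 : ℝ) : ℂ) * (𝐞 ((n : ℝ) * α) : ℂ) :=
        Finset.sum_congr rfl fun n hn => Finset.sum_congr rfl fun p hp => (hF n hn p hp).symm
    _ = expSumOf (fun n : ℕ => ∑ p ∈ (range (N + 1) ×ˢ range (M + 1)).filter (fun p : ℕ × ℕ => p.1 + p.2 = n), f p.1 * g p.2) (N + M) α := by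
        unfold expSumOf
        refine Finset.sum_congr rfl fun n _ => ?_
        rw [Complex.ofReal_sum, Finset.sum_mul]

/-- **Parseval for a product**: `∑_n (f ∗ g)(n)² = ∫₀¹ |f̂(α)|² |ĝ(α)|² dα`.
[cite: Vaughan1997, §3.1 (Parseval's identity for the generating functions)] -/
theorem sum_conv_sq_eq_integral (f g : ℕ → ℝ) (N M : ℕ) :
    ∑ n ∈ range (N + M + 1), (∑ p ∈ (range (N + 1) ×ˢ range (M + 1)).filter (fun p : ℕ × ℕ => p.1 + p.2 = n), f p.1 * g p.2) ^ 2 =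
      ∫ α in (0 : ℝ)..1, ‖expSumOf f N α‖ ^ 2 * ‖expSumOf g M α‖ ^ 2 := by
  have h := integral_norm_sq_expSumOf (fun n : ℕ => ∑ p ∈ (range (N + 1) ×ˢ range (M + 1)).filter (fun p : ℕ × ℕ => p.1 + p.2 = n), f p.1 * g p.2) (N + M)
  beta_reduce at h
  rw [← h]
  refine intervalIntegral.integral_congr fun α _ => ?_
  show ‖expSumOf (fun n : ℕ => ∑ p ∈ (range (N + 1) ×ˢ range (M + 1)).filter (fun p : ℕ × ℕ => p.1 + p.2 = n), f p.1 * g p.2) (N + M) α‖ ^ 2 =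
    ‖expSumOf f N α‖ ^ 2 * ‖expSumOf g M α‖ ^ 2
  rw [← expSumOf_mul, norm_mul, mul_pow]

/-- Continuity of `α ↦ ‖f̂(α)‖^k` (private helper). [folklore] -/
private theorem continuous_norm_expSumOf_pow (f : ℕ → ℝ) (N k : ℕ) :
    Continuous fun α : ℝ => ‖expSumOf f N α‖ ^ k :=
  ((continuous_expSumOf f N).norm).pow k

/-- **The mean-square convolution bound** (Parseval and the majorant principle): if `|ĝ(α)| ≤ G`
for all `α`, then for every `λ > 0`,
`∑_n (f ∗ g)(n)² ≤ ½ (λ² ∫₀¹|f̂|⁴ + λ⁻² G² ∑_{m ≤ M} g(m)²)`.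
[cite: Vaughan1997, §3.2 (the minor-arc treatment: sup of one generating function times the mean square of the other); Montgomery1994, Chapter 7 §3] -/
theorem sum_conv_sq_le {f g : ℕ → ℝ} {N M : ℕ} {G lam : ℝ} (hG : ∀ α : ℝ, ‖expSumOf g M α‖ ≤ G)
    (hlam : 0 < lam) :
    ∑ n ∈ range (N + M + 1), (∑ p ∈ (range (N + 1) ×ˢ range (M + 1)).filter (fun p : ℕ × ℕ => p.1 + p.2 = n), f p.1 * g p.2) ^ 2 ≤
      (lam ^ 2 * (∫ α in (0 : ℝ)..1, ‖expSumOf f N α‖ ^ 4) +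
        lam⁻¹ ^ 2 * (G ^ 2 * ∑ m ∈ range (M + 1), g m ^ 2)) / 2 := by
  rw [sum_conv_sq_eq_integral f g N M]
  have hG0 : 0 ≤ G := le_trans (norm_nonneg _) (hG 0)
  -- pointwise: `a² b² ≤ ½ (λ² a⁴ + λ⁻² G² b²)`
  have hpt : ∀ α ∈ Set.Icc (0 : ℝ) 1, ‖expSumOf f N α‖ ^ 2 * ‖expSumOf g M α‖ ^ 2 ≤
      lam ^ 2 / 2 * ‖expSumOf f N α‖ ^ 4 + lam⁻¹ ^ 2 * G ^ 2 / 2 * ‖expSumOf g M α‖ ^ 2 := by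
    intro α _
    set a := ‖expSumOf f N α‖ with ha
    set b := ‖expSumOf g M α‖ with hb
    have ha0 : 0 ≤ a := norm_nonneg _
    have hb0 : 0 ≤ b := norm_nonneg _
    have hbG : b ≤ G := hG α
    have hb4 : b ^ 4 ≤ G ^ 2 * b ^ 2 := by
      have : b ^ 2 ≤ G ^ 2 := pow_le_pow_left₀ hb0 hbG 2
      nlinarith [sq_nonneg b]
    -- AM–GM: `2 (λ a²)(λ⁻¹ b²) ≤ λ² a⁴ + λ⁻² b⁴`
    have hamgm : 2 * (a ^ 2 * b ^ 2) ≤ lam ^ 2 * a ^ 4 + lam⁻¹ ^ 2 * b ^ 4 := by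
      have h := sq_nonneg (lam * a ^ 2 - lam⁻¹ * b ^ 2)
      have hll : lam * lam⁻¹ = 1 := mul_inv_cancel₀ hlam.ne'
      have e : lam * lam⁻¹ * (a ^ 2 * b ^ 2) = a ^ 2 * b ^ 2 := by rw [hll, one_mul]
      nlinarith [h, e]
    have hl2 : 0 ≤ lam⁻¹ ^ 2 := sq_nonneg _
    nlinarith [hamgm, mul_le_mul_of_nonneg_left hb4 hl2]
  have hi1 : IntervalIntegrable (fun α : ℝ => ‖expSumOf f N α‖ ^ 2 * ‖expSumOf g M α‖ ^ 2)
      volume 0 1 :=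
    ((continuous_norm_expSumOf_pow f N 2).mul (continuous_norm_expSumOf_pow g M 2)).intervalIntegrable _ _
  have hi4 : IntervalIntegrable (fun α : ℝ => ‖expSumOf f N α‖ ^ 4) volume 0 1 :=
    (continuous_norm_expSumOf_pow f N 4).intervalIntegrable _ _
  have hi2 : IntervalIntegrable (fun α : ℝ => ‖expSumOf g M α‖ ^ 2) volume 0 1 :=
    (continuous_norm_expSumOf_pow g M 2).intervalIntegrable _ _
  have hrhs : IntervalIntegrable (fun α : ℝ => lam ^ 2 / 2 * ‖expSumOf f N α‖ ^ 4 +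
      lam⁻¹ ^ 2 * G ^ 2 / 2 * ‖expSumOf g M α‖ ^ 2) volume 0 1 :=
    (hi4.const_mul _).add (hi2.const_mul _)
  have hmono := intervalIntegral.integral_mono_on zero_le_one hi1 hrhs hpt
  have hI : ∫ α in (0 : ℝ)..1, (lam ^ 2 / 2 * ‖expSumOf f N α‖ ^ 4 +
      lam⁻¹ ^ 2 * G ^ 2 / 2 * ‖expSumOf g M α‖ ^ 2) =
      lam ^ 2 / 2 * (∫ α in (0 : ℝ)..1, ‖expSumOf f N α‖ ^ 4) +
        lam⁻¹ ^ 2 * G ^ 2 / 2 * (∫ α in (0 : ℝ)..1, ‖expSumOf g M α‖ ^ 2) := by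
    rw [intervalIntegral.integral_add (hi4.const_mul _) (hi2.const_mul _)]
    rw [intervalIntegral.integral_const_mul (lam ^ 2 / 2) (fun α : ℝ => ‖expSumOf f N α‖ ^ 4)]
    rw [intervalIntegral.integral_const_mul (lam⁻¹ ^ 2 * G ^ 2 / 2) (fun α : ℝ => ‖expSumOf g M α‖ ^ 2)]
  rw [hI, integral_norm_sq_expSumOf g M] at hmono
  refine hmono.trans (le_of_eq ?_)
  ring

/-! ### The route's double sum is a sum of squares of the additive convolution -/

/-- For `n ≤ M`: `(f ∗ g)(n) = ∑_{k ≤ min(n, N)} f(k) g(n − k)`. [folklore] -/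
private theorem conv_eq_sum_range {f g : ℕ → ℝ} {N M n : ℕ} (hn : n ≤ M) :
    ∑ p ∈ (range (N + 1) ×ˢ range (M + 1)).filter (fun p : ℕ × ℕ => p.1 + p.2 = n), f p.1 * g p.2 =
      ∑ k ∈ (range (N + 1)).filter (fun k => k ≤ n), f k * g (n - k) := by
  rw [sum_filter, sum_product, sum_filter]
  refine sum_congr rfl fun k hk => ?_
  by_cases hkn : k ≤ n
  · rw [if_pos hkn]
    have hmem : n - k ∈ range (M + 1) := by rw [mem_range]; omega
    rw [← Finset.sum_filter]
    have hfilt : (range (M + 1)).filter (fun m => k + m = n) = {n - k} := by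
      ext m
      simp only [mem_filter, mem_range, mem_singleton]
      constructor
      · rintro ⟨-, h⟩; omega
      · rintro rfl; exact ⟨by omega, by omega⟩
    rw [hfilt, sum_singleton]
  · rw [if_neg hkn]
    refine sum_eq_zero fun m _ => ?_
    rw [if_neg]
    omega

/-- **The route's double sum**: for `u` with `u(0) = 0` and `n ∈ (N, 2N]`,
`∑_{k ∈ [1,N]} u(k) b(n − k) = (u ∗ b)(n)` (convolution on `[0,N] × [0,2N]`).
[cite: Vaughan1997, §3.1 (the generating-function identity for additive representations)] -/
theorem sum_Icc_mul_eq_conv {u b : ℕ → ℝ} {N n : ℕ} (hu : u 0 = 0) (hn1 : N < n) (hn2 : n ≤ 2 * N) :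
    ∑ k ∈ Icc 1 N, u k * b (n - k) =
      ∑ p ∈ (range (N + 1) ×ˢ range (2 * N + 1)).filter (fun p : ℕ × ℕ => p.1 + p.2 = n), u p.1 * b p.2 := by
  rw [conv_eq_sum_range hn2]
  have hfilt : (range (N + 1)).filter (fun k => k ≤ n) = insert 0 (Icc 1 N) := by
    ext k
    simp only [mem_filter, mem_range, mem_insert, mem_Icc]
    omega
  rw [hfilt, sum_insert (by simp), hu, zero_mul, zero_add]

/-- **Positivity step**: `∑_{N<n≤2N} (∑_{k∈[1,N]} u(k) b(n−k))² ≤ ∑_{n ≤ 3N} (u ∗ b)(n)²`.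
[cite: Vaughan1997, §3.1 (the generating-function identity for additive representations)] -/
theorem sum_Ioc_sq_le {u b : ℕ → ℝ} {N : ℕ} (hu : u 0 = 0) :
    ∑ n ∈ Ioc N (2 * N), (∑ k ∈ Icc 1 N, u k * b (n - k)) ^ 2 ≤
      ∑ n ∈ range (N + 2 * N + 1), (∑ p ∈ (range (N + 1) ×ˢ range (2 * N + 1)).filter (fun p : ℕ × ℕ => p.1 + p.2 = n), u p.1 * b p.2) ^ 2 := by
  have heq : ∑ n ∈ Ioc N (2 * N), (∑ k ∈ Icc 1 N, u k * b (n - k)) ^ 2 =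
      ∑ n ∈ Ioc N (2 * N), (∑ p ∈ (range (N + 1) ×ˢ range (2 * N + 1)).filter (fun p : ℕ × ℕ => p.1 + p.2 = n), u p.1 * b p.2) ^ 2 := by
    refine sum_congr rfl fun n hn => ?_
    rw [mem_Ioc] at hn
    rw [sum_Icc_mul_eq_conv hu hn.1 hn.2]
  rw [heq]
  refine sum_le_sum_of_subset_of_nonneg (fun n hn => ?_) fun n _ _ => sq_nonneg _
  rw [mem_Ioc] at hn; rw [mem_range]; omega

/-! ### The two generating functions of the route: `f̂₃` and `(θ·𝟙_ℙ − g_z)^` -/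

/-- `|θ𝟙_ℙ(m) − Λ(m)| = 𝟙[m not prime] Λ(m)`. [folklore] -/
private theorem abs_thetaWeight_sub_vonMangoldt (m : ℕ) :
    |(if m.Prime then Real.log (m : ℝ) else 0) - Λ m| = if m.Prime then 0 else Λ m := by
  split_ifs with h
  · rw [vonMangoldt_apply_prime h, sub_self, abs_zero]
  · rw [zero_sub, abs_neg, abs_of_nonneg vonMangoldt_nonneg]

/-- `∑_{n ≤ M} F(n) = ∑_{1 ≤ n ≤ M} F(n)` when `F(0) = 0` (private helper). [folklore] -/
private theorem sum_range_succ_eq_sum_Icc {R : Type*} [AddCommMonoid R] {F : ℕ → R} (hF : F 0 = 0)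
    (M : ℕ) : ∑ n ∈ range (M + 1), F n = ∑ n ∈ Icc 1 M, F n := by
  have h : range (M + 1) = insert 0 (Icc 1 M) := by
    ext n; simp only [mem_range, mem_insert, mem_Icc]; omega
  rw [h, sum_insert (by simp), hF, zero_add]

/-- `[1, M] = (0, M]` in `ℕ` (private helper). [folklore] -/
private theorem Ioc_zero_eq_Icc_one (M : ℕ) : Ioc 0 M = Icc 1 M := by
  ext n; simp only [mem_Ioc, mem_Icc]; omega

/-- `f̂₃ = expSumOf f₃` (`f₃(0) = 0`). [folklore] -/
private theorem expSumOf_hbWeight_eq (c : ℝ) (N : ℕ) (α : ℝ) :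
    expSumOf (hbWeight c N) N α = hbExpSum c N α := by
  unfold expSumOf hbExpSum
  exact sum_range_succ_eq_sum_Icc (by simp [hbWeight]) N

/-- `g_z(0) = 0` once `z > 2` (then `2 ∣ P(z)`, so `(0, P(z)) = P(z) ≠ 1`). [folklore] -/
private theorem roughModel_zero {B : ℝ} {N : ℕ} (hz : 2 < roughLevel B N) : roughModel B N 0 = 0 := by
  unfold roughModel
  rw [if_neg]
  intro h
  rw [Nat.coprime_zero_left] at h
  have h2 : 2 ∣ roughPrimorial B N := by
    rw [roughPrimorial, dvd_primesProdBelow_iff Nat.prime_two]; exact_mod_cast hz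
  rw [h] at h2
  exact absurd (Nat.le_of_dvd one_pos h2) (by norm_num)

/-- **The second generating function is `Ŝ_Λ − ĝ_z` up to prime powers**: for `z > 2`,
`‖(θ𝟙_ℙ − g_z)^(α)‖ ≤ ‖Ŝ_Λ(α) − ĝ_z(α)‖ + (ψ(2N) − θ(2N))` (sums up to `2N`).
[cite: Vaughan1997, §3.1 (passage between `Λ`- and `log p`-weighted generating functions costs ψ − θ)] -/
theorem norm_expSumOf_thetaWeight_sub_le (B : ℝ) (N : ℕ) (hz : 2 < roughLevel B (2 * N)) (α : ℝ) :
    ‖expSumOf (fun m : ℕ => (if m.Prime then Real.log (m : ℝ) else 0) - roughModel B (2 * N) m) (2 * N) α‖ ≤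
      ‖primeExpSum (2 * N) α - roughExpSum B (2 * N) α‖ +
        (ψ ((2 * N : ℕ) : ℝ) - θ ((2 * N : ℕ) : ℝ)) := by
  -- split the coefficient `tw − g = (Λ − g) + (tw − Λ)`
  have hsplit : expSumOf (fun m : ℕ => (if m.Prime then Real.log (m : ℝ) else 0) - roughModel B (2 * N) m) (2 * N) α =
      (primeExpSum (2 * N) α - roughExpSum B (2 * N) α) +
        ∑ m ∈ range (2 * N + 1), ((((if m.Prime then Real.log (m : ℝ) else 0) - Λ m : ℝ) : ℂ) * (𝐞 ((m : ℝ) * α) : ℂ)) := by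
    have h1 : primeExpSum (2 * N) α - roughExpSum B (2 * N) α =
        ∑ m ∈ range (2 * N + 1), (((Λ m - roughModel B (2 * N) m : ℝ) : ℂ) * (𝐞 ((m : ℝ) * α) : ℂ)) := by
      rw [sum_range_succ_eq_sum_Icc (by
        rw [ArithmeticFunction.map_zero, roughModel_zero hz, sub_zero, Complex.ofReal_zero, zero_mul])]
      unfold primeExpSum roughExpSum
      rw [← sum_sub_distrib]
      refine sum_congr rfl fun m _ => ?_
      push_cast; ring
    rw [h1, ← sum_add_distrib]
    unfold expSumOf
    refine sum_congr rfl fun m _ => ?_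
    push_cast; ring
  rw [hsplit]
  refine (norm_add_le _ _).trans (add_le_add le_rfl ?_)
  -- the prime-power sum
  refine (norm_sum_le _ _).trans ?_
  have hterm : ∀ m ∈ range (2 * N + 1),
      ‖(((if m.Prime then Real.log (m : ℝ) else 0) - Λ m : ℝ) : ℂ) * (𝐞 ((m : ℝ) * α) : ℂ)‖ = if m.Prime then 0 else Λ m := by
    intro m _
    rw [norm_mul, Circle.norm_coe, mul_one, Complex.norm_real, Real.norm_eq_abs,
      abs_thetaWeight_sub_vonMangoldt]
  rw [sum_congr rfl hterm, Chebyshev.psi_sub_theta_eq_sum_not_prime, Nat.floor_natCast,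
    sum_filter]
  have h0 : (if (0 : ℕ).Prime then (0 : ℝ) else Λ 0) = 0 := by
    rw [if_neg Nat.not_prime_zero, ArithmeticFunction.map_zero]
  rw [sum_range_succ_eq_sum_Icc h0, Ioc_zero_eq_Icc_one]
  refine le_of_eq (sum_congr rfl fun n _ => ?_)
  by_cases hn : n.Prime
  · rw [if_pos hn, if_neg (not_not.mpr hn)]
  · rw [if_neg hn, if_pos hn]

/-- **Mean square of the second weight**: for `z = (log 2N)^B > 2` with `z ≤ D`... concretely
`∑_{m ≤ 2N} (θ𝟙_ℙ − g_z)(m)² ≤ 2(2N+1) log²(2N) + 2(2N · (P/φ(P)) (1 + C) + C z⁵)` with the pair-correlation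
constant `C` of `exists_pairCorrelation_bound`. [cite: HalberstamRichert1974, Thm 2.5 (mean value of the sifted indicator)] -/
theorem sum_sq_thetaWeight_sub_le {B C : ℝ} (hC0 : 0 < C)
    (hC : ∀ (N M₁ M h : ℕ) (D : ℝ), 2 ≤ roughLevel B N → roughLevel B N ≤ D →
      |∑ m ∈ Ioc M₁ (M₁ + M), roughModel B N m * roughModel B N (m + h) -
          M * pairSingSeries B N h| ≤
        C * ((M : ℝ) * pairSingSeries B N h * Real.exp (-(Real.log D / Real.log (roughLevel B N))) +
          D * roughLevel B N ^ 4))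
    (N : ℕ) (hz : 2 < roughLevel B (2 * N)) :
    ∑ m ∈ range (2 * N + 1), ((if m.Prime then Real.log (m : ℝ) else 0) - roughModel B (2 * N) m) ^ 2 ≤
      2 * ((2 * N + 1 : ℕ) * Real.log ((2 * N : ℕ) : ℝ) ^ 2) +
        2 * ((2 * N : ℕ) * ((roughPrimorial B (2 * N) : ℝ) /
              (Nat.totient (roughPrimorial B (2 * N)) : ℝ)) * (1 + C) +
            C * roughLevel B (2 * N) ^ 5) := by
  have hsq : ∀ m ∈ range (2 * N + 1), ((if m.Prime then Real.log (m : ℝ) else 0) - roughModel B (2 * N) m) ^ 2 ≤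
      2 * (if m.Prime then Real.log (m : ℝ) else 0) ^ 2 + 2 * roughModel B (2 * N) m ^ 2 := fun m _ => by
    nlinarith [sq_nonneg ((if m.Prime then Real.log (m : ℝ) else 0) + roughModel B (2 * N) m)]
  refine (sum_le_sum hsq).trans ?_
  rw [sum_add_distrib, ← mul_sum, ← mul_sum]
  refine add_le_add (mul_le_mul_of_nonneg_left ?_ zero_le_two)
    (mul_le_mul_of_nonneg_left ?_ zero_le_two)
  · -- `θ`-part: each term at most `log²(2N)`
    have hb : ∀ m ∈ range (2 * N + 1), (if m.Prime then Real.log (m : ℝ) else 0) ^ 2 ≤ Real.log ((2 * N : ℕ) : ℝ) ^ 2 := by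
      intro m hm
      rw [mem_range] at hm
      split_ifs with hp
      · refine pow_le_pow_left₀ (Real.log_natCast_nonneg m) ?_ 2
        exact Real.log_le_log (by exact_mod_cast hp.pos) (by exact_mod_cast (by omega : m ≤ 2 * N))
      · rw [zero_pow two_ne_zero]; exact sq_nonneg _
    refine (sum_le_card_nsmul _ _ _ hb).trans ?_
    rw [card_range, nsmul_eq_mul]
  · -- `g`-part: the pair correlation at `h = 0`, `D = z`
    have hz2 : (2 : ℝ) ≤ roughLevel B (2 * N) := hz.le
    have h := hC (2 * N) 0 (2 * N) 0 (roughLevel B (2 * N)) hz2 le_rfl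
    have hS0 : pairSingSeries B (2 * N) 0 = (roughPrimorial B (2 * N) : ℝ) /
        (Nat.totient (roughPrimorial B (2 * N)) : ℝ) := pairSingSeries_zero B (2 * N)
    have hlogz : 0 < Real.log (roughLevel B (2 * N)) := Real.log_pos (by linarith)
    have hexp : Real.exp (-(Real.log (roughLevel B (2 * N)) / Real.log (roughLevel B (2 * N)))) ≤ 1 := by
      rw [div_self hlogz.ne']; exact Real.exp_le_one_iff.mpr (by norm_num)
    have hsum : ∑ m ∈ range (2 * N + 1), roughModel B (2 * N) m ^ 2 =
        ∑ m ∈ Ioc 0 (0 + 2 * N), roughModel B (2 * N) m * roughModel B (2 * N) (m + 0) := by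
      rw [sum_range_succ_eq_sum_Icc (by rw [roughModel_zero hz]; ring) (2 * N), zero_add,
        Ioc_zero_eq_Icc_one]
      exact sum_congr rfl fun m _ => by rw [add_zero, sq]
    rw [hsum]
    have hQ0 : 0 ≤ (roughPrimorial B (2 * N) : ℝ) / (Nat.totient (roughPrimorial B (2 * N)) : ℝ) := by
      positivity
    have h' := (abs_le.mp h).2
    rw [hS0] at h'
    have hz0 : 0 ≤ roughLevel B (2 * N) := by linarith
    have hbound : C * (((2 * N : ℕ) : ℝ) * ((roughPrimorial B (2 * N) : ℝ) /
        (Nat.totient (roughPrimorial B (2 * N)) : ℝ)) *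
          Real.exp (-(Real.log (roughLevel B (2 * N)) / Real.log (roughLevel B (2 * N)))) +
        roughLevel B (2 * N) * roughLevel B (2 * N) ^ 4) ≤
        C * (((2 * N : ℕ) : ℝ) * ((roughPrimorial B (2 * N) : ℝ) /
          (Nat.totient (roughPrimorial B (2 * N)) : ℝ)) + roughLevel B (2 * N) ^ 5) := by
      refine mul_le_mul_of_nonneg_left (add_le_add ?_ (le_of_eq (by ring))) hC0.le
      exact mul_le_of_le_one_right (mul_nonneg (Nat.cast_nonneg _) hQ0) hexp
    push_cast at h' hbound ⊢
    nlinarith [h', hbound, hQ0, hC0]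


/-- **Mertens for `P/φ(P)`**: `P(z)/φ(P(z)) ≤ e⁵ log z` for `z ≥ 3` (the tree's elementary lower bound
`∏_{p ≤ M}(1 − 1/p) ≥ e^{−5}/log M`, `MertensElementary`).
[cite: HardyWright2008, Thm 429 (§22.8) (Mertens' product theorem, up to the constant)] -/
theorem primesProdBelow_div_totient_le_exp_mul_log {z : ℝ} (hz : 3 ≤ z) :
    (primesProdBelow z : ℝ) / (Nat.totient (primesProdBelow z) : ℝ) ≤ Real.exp 5 * Real.log z := by
  rw [primesProdBelow_div_totient]
  have hz0 : 0 < z := by linarith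
  obtain ⟨M, hM⟩ : ∃ M : ℕ, ⌈z⌉₊ = M + 1 :=
    ⟨⌈z⌉₊ - 1, by have := Nat.ceil_pos.mpr hz0; omega⟩
  have h3 : 3 ≤ ⌈z⌉₊ := by exact_mod_cast hz.trans (Nat.le_ceil z)
  have hM2 : 2 ≤ M := by omega
  have hMz : (M : ℝ) ≤ z := by
    have h := Nat.ceil_lt_add_one hz0.le
    rw [hM] at h; push_cast at h; linarith
  have hM0 : (0 : ℝ) < M := by exact_mod_cast (by omega : 0 < M)
  have hlogM : 0 < Real.log M := Real.log_pos (by exact_mod_cast (by omega : 1 < M))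
  rw [hM, show Nat.primesBelow (M + 1) = Nat.primesLE M from rfl]
  have hmert := Literature.NumberTheory.LFunctions.MertensBound.exp_neg_div_log_le_prod_one_sub_inv M hM2
  have hprod : ∏ p ∈ Nat.primesLE M, ((p : ℝ) / ((p : ℝ) - 1)) =
      (∏ p ∈ Nat.primesLE M, (1 - 1 / (p : ℝ)))⁻¹ := by
    rw [← prod_inv_distrib]
    refine prod_congr rfl fun p hp => ?_
    have hp2 : (2 : ℝ) ≤ p := by exact_mod_cast (Nat.prime_of_mem_primesLE hp).two_le
    have hp1 : (p : ℝ) - 1 ≠ 0 := by linarith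
    have hp0 : (p : ℝ) ≠ 0 := by linarith
    field_simp
  rw [hprod]
  have hpos : 0 < Real.exp (-5) / Real.log M := div_pos (Real.exp_pos _) hlogM
  calc (∏ p ∈ Nat.primesLE M, (1 - 1 / (p : ℝ)))⁻¹ ≤ (Real.exp (-5) / Real.log M)⁻¹ := inv_anti₀ hpos hmert
    _ = Real.exp 5 * Real.log M := by rw [inv_div, Real.exp_neg, div_inv_eq_mul, mul_comm]
    _ ≤ Real.exp 5 * Real.log z :=
        mul_le_mul_of_nonneg_left (Real.log_le_log hM0 hMz) (Real.exp_pos _).le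

/-- `z = (log 2N)^B → ∞` (private helper). [folklore] -/
private theorem tendsto_roughLevel_two_mul' {B : ℝ} (hB : 0 < B) :
    Filter.Tendsto (fun N : ℕ => roughLevel B (2 * N)) Filter.atTop Filter.atTop := by
  have h2N : Filter.Tendsto (fun N : ℕ => ((2 * N : ℕ) : ℝ)) Filter.atTop Filter.atTop :=
    tendsto_natCast_atTop_atTop.comp
      (Filter.tendsto_atTop_mono (fun N : ℕ => show id N ≤ 2 * N by dsimp only [id]; omega)
        Filter.tendsto_id)
  exact ((tendsto_rpow_atTop hB).comp (Real.tendsto_log_atTop.comp h2N)).congr fun N => rfl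

/-- `(log 2N)^r ≤ N` eventually (private helper). [folklore] -/
private theorem eventually_log_two_mul_rpow_le (r : ℝ) :
    ∀ᶠ N : ℕ in Filter.atTop, Real.log ((2 * N : ℕ) : ℝ) ^ r ≤ N := by
  have h2N : Filter.Tendsto (fun N : ℕ => ((2 * N : ℕ) : ℝ)) Filter.atTop Filter.atTop :=
    tendsto_natCast_atTop_atTop.comp
      (Filter.tendsto_atTop_mono (fun N : ℕ => show id N ≤ 2 * N by dsimp only [id]; omega)
        Filter.tendsto_id)
  have hlo := (isLittleO_log_rpow_rpow_atTop r (by norm_num : (0 : ℝ) < 1)).bound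
    (show (0 : ℝ) < 1 / 2 by norm_num)
  filter_upwards [h2N.eventually hlo, h2N.eventually (Filter.eventually_gt_atTop 1)] with N hN h1
  have hlog : 0 < Real.log ((2 * N : ℕ) : ℝ) := Real.log_pos h1
  rw [Real.rpow_one, Real.norm_of_nonneg (Real.rpow_nonneg hlog.le _),
    Real.norm_of_nonneg (by positivity)] at hN
  refine hN.trans (le_of_eq ?_)
  push_cast; ring

/-- The final book-keeping with powers of `L = log N`. [folklore] -/
private theorem fourier_final {S I4 Sb G E N L A C₄ c₁ C₂ Kb : ℝ} (hL : 1 ≤ L) (hN : 0 < N)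
    (hS : S ≤ (L ^ (-(A + C₄)) * I4 + (L ^ (-(A + C₄)))⁻¹ * (G ^ 2 * Sb)) / 2)
    (hI4 : I4 ≤ c₁ * N ^ 3 * L ^ C₄) (hG0 : 0 ≤ G)
    (hG : G ≤ C₂ * (2 * N) * L ^ (-(A + |C₄| + 2)) + E) (hE2 : E ^ 2 ≤ 32 * N * L ^ 2)
    (hSb0 : 0 ≤ Sb) (hSb : Sb ≤ Kb * N * L ^ 2) (hKb : 0 ≤ Kb) (hA : 0 < A)
    (hgrow : L ^ (2 * A + C₄ + 4) ≤ N) :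
    S ≤ (|c₁| + 8 * C₂ ^ 2 * Kb + 64 * Kb) * N ^ 3 * L ^ (-A) := by
  have hL0 : 0 < L := by linarith
  have hrp : ∀ x : ℝ, 0 < L ^ x := fun x => Real.rpow_pos_of_pos hL0 x
  -- first term
  have h1 : L ^ (-(A + C₄)) * I4 ≤ |c₁| * N ^ 3 * L ^ (-A) := by
    have hI4' : I4 ≤ |c₁| * N ^ 3 * L ^ C₄ :=
      hI4.trans (mul_le_mul_of_nonneg_right (mul_le_mul_of_nonneg_right (le_abs_self c₁)
        (pow_nonneg hN.le 3)) (hrp C₄).le)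
    calc L ^ (-(A + C₄)) * I4 ≤ L ^ (-(A + C₄)) * (|c₁| * N ^ 3 * L ^ C₄) :=
          mul_le_mul_of_nonneg_left hI4' (hrp _).le
      _ = |c₁| * N ^ 3 * (L ^ (-(A + C₄)) * L ^ C₄) := by ring
      _ = |c₁| * N ^ 3 * L ^ (-A) := by
          rw [← Real.rpow_add hL0]; congr 1; ring_nf
  -- `G² ≤ 8 C₂² N² L^{-2A'} + 64 N L²`
  have hA'0 : -(A + |C₄| + 2) ≤ 0 := by linarith [abs_nonneg C₄]
  have hG2 : G ^ 2 ≤ 8 * C₂ ^ 2 * N ^ 2 * L ^ (-(2 * (A + |C₄| + 2))) + 64 * N * L ^ 2 := by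
    have hsq : G ^ 2 ≤ 2 * (C₂ * (2 * N) * L ^ (-(A + |C₄| + 2))) ^ 2 + 2 * E ^ 2 := by
      have := pow_le_pow_left₀ hG0 hG 2
      nlinarith [sq_nonneg (C₂ * (2 * N) * L ^ (-(A + |C₄| + 2)) - E)]
    have e : (L ^ (-(A + |C₄| + 2))) ^ 2 = L ^ (-(2 * (A + |C₄| + 2))) := by
      rw [← Real.rpow_natCast, ← Real.rpow_mul hL0.le]; congr 1; push_cast; ring
    calc G ^ 2 ≤ 2 * (C₂ * (2 * N) * L ^ (-(A + |C₄| + 2))) ^ 2 + 2 * E ^ 2 := hsq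
      _ = 8 * C₂ ^ 2 * N ^ 2 * (L ^ (-(A + |C₄| + 2))) ^ 2 + 2 * E ^ 2 := by ring
      _ ≤ 8 * C₂ ^ 2 * N ^ 2 * L ^ (-(2 * (A + |C₄| + 2))) + 64 * N * L ^ 2 := by
          rw [e]; linarith
  -- second term
  have hinv : (L ^ (-(A + C₄)))⁻¹ = L ^ (A + C₄) := by
    rw [Real.rpow_neg hL0.le, inv_inv]
  have hexp1 : L ^ (A + C₄) * L ^ (-(2 * (A + |C₄| + 2))) * L ^ (2 : ℝ) ≤ L ^ (-A) := by
    rw [← Real.rpow_add hL0, ← Real.rpow_add hL0]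
    refine Real.rpow_le_rpow_of_exponent_le hL ?_
    have : C₄ ≤ |C₄| := le_abs_self C₄
    have : -C₄ ≤ |C₄| := neg_le_abs C₄
    linarith
  have hexp2 : L ^ (A + C₄) * L ^ (2 : ℝ) * L ^ (2 : ℝ) ≤ N * L ^ (-A) := by
    rw [← Real.rpow_add hL0, ← Real.rpow_add hL0]
    have e : L ^ (A + C₄ + 2 + 2) = L ^ (2 * A + C₄ + 4) * L ^ (-A) := by
      rw [← Real.rpow_add hL0]; congr 1; ring
    rw [e]
    exact mul_le_mul_of_nonneg_right hgrow (hrp _).le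
  have hL2 : L ^ (2 : ℝ) = L ^ 2 := by rw [← Real.rpow_natCast]; norm_num
  have h2 : (L ^ (-(A + C₄)))⁻¹ * (G ^ 2 * Sb) ≤ (8 * C₂ ^ 2 * Kb + 64 * Kb) * N ^ 3 * L ^ (-A) := by
    rw [hinv]
    have hGS : G ^ 2 * Sb ≤ (8 * C₂ ^ 2 * N ^ 2 * L ^ (-(2 * (A + |C₄| + 2))) + 64 * N * L ^ 2) *
        (Kb * N * L ^ 2) := mul_le_mul hG2 hSb hSb0 (by positivity)
    calc L ^ (A + C₄) * (G ^ 2 * Sb)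
        ≤ L ^ (A + C₄) * ((8 * C₂ ^ 2 * N ^ 2 * L ^ (-(2 * (A + |C₄| + 2))) + 64 * N * L ^ 2) *
            (Kb * N * L ^ 2)) := mul_le_mul_of_nonneg_left hGS (hrp _).le
      _ = 8 * C₂ ^ 2 * Kb * N ^ 3 * (L ^ (A + C₄) * L ^ (-(2 * (A + |C₄| + 2))) * L ^ (2 : ℝ)) +
            64 * Kb * N ^ 2 * (L ^ (A + C₄) * L ^ (2 : ℝ) * L ^ (2 : ℝ)) := by rw [hL2]; ring
      _ ≤ 8 * C₂ ^ 2 * Kb * N ^ 3 * L ^ (-A) + 64 * Kb * N ^ 2 * (N * L ^ (-A)) :=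
          add_le_add (mul_le_mul_of_nonneg_left hexp1 (by positivity))
            (mul_le_mul_of_nonneg_left hexp2 (by positivity))
      _ = (8 * C₂ ^ 2 * Kb + 64 * Kb) * N ^ 3 * L ^ (-A) := by ring
  have htot : 0 ≤ (|c₁| + 8 * C₂ ^ 2 * Kb + 64 * Kb) * N ^ 3 * L ^ (-A) := by positivity
  calc S ≤ (L ^ (-(A + C₄)) * I4 + (L ^ (-(A + C₄)))⁻¹ * (G ^ 2 * Sb)) / 2 := hS
    _ ≤ ((|c₁| * N ^ 3 * L ^ (-A)) + (8 * C₂ ^ 2 * Kb + 64 * Kb) * N ^ 3 * L ^ (-A)) / 2 := by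
        gcongr
    _ ≤ (|c₁| + 8 * C₂ ^ 2 * Kb + 64 * Kb) * N ^ 3 * L ^ (-A) := by
        have e : (|c₁| * N ^ 3 * L ^ (-A)) + (8 * C₂ ^ 2 * Kb + 64 * Kb) * N ^ 3 * L ^ (-A) =
            (|c₁| + 8 * C₂ ^ 2 * Kb + 64 * Kb) * N ^ 3 * L ^ (-A) := by ring
        rw [e]; linarith

/-- **The Fourier-side comparison for `n = p + (x³ + 2y³)`** — VERBATIM the support item
«FourierSideComparison» of the parity-ideate route `GoldbachHeathBrownDispersion`: for every box
exponent `c > 0` and every `A > 0` there are `B = B(c, A) > 0`, `C`, `N₀` with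
`∑_{N<n≤2N} (∑_{k≤N} f₃(k)·(θ𝟙_ℙ(n−k) − g_z(n−k)))² ≤ C N³ (log N)^{−A}` for `N ≥ N₀`
(`g_z` the rough model at `2N`, `z = (log 2N)^B`).  Proof: Parseval for the product of the two
generating functions, the mean-square convolution bound `sum_conv_sq_le` with
`λ² = (log N)^{−A−C₄}`, the tree's `L⁴` bound for `f̂₃` (`hbFourierFourthMoment_holds`) and
uniform approximation `‖Ŝ_Λ − ĝ_z‖_∞ ≪ N(log N)^{−A'}` (`roughModelFourierApprox_holds`,
`A' = A + |C₄| + 2`), Chebyshev's `ψ − θ ≤ 2√x log x`, and `∑ g_z² ≪ N log z` (pair correlation at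
`h = 0` and Mertens). [cite: Vaughan1997, §3.1–§3.2 (Parseval and the minor-arc bound); MontgomeryVaughan1975, §7 (the exceptional set in Goldbach's problem by the variance)] -/
theorem fourierSideComparison :
    ∀ c : ℝ, 0 < c → ∀ A : ℝ, 0 < A → ∃ B : ℝ, 0 < B ∧ ∃ C : ℝ, ∃ N₀ : ℕ, ∀ N : ℕ, N₀ ≤ N →
      ∑ n ∈ Ioc N (2 * N), (∑ k ∈ Icc 1 N, hbWeight c N k *
        ((if (n - k).Prime then Real.log ((n - k : ℕ) : ℝ) else 0) - roughModel B (2 * N) (n - k))) ^ 2 ≤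
      C * (N : ℝ) ^ 3 * Real.log N ^ (-A) := by
  intro c hc A hA
  obtain ⟨C₄, c₁, h4⟩ := hbFourierFourthMoment_holds c hc
  obtain ⟨B, hB, C₂, N₁, happrox⟩ := roughModelFourierApprox_holds (A + |C₄| + 2) (by positivity)
  obtain ⟨Cpc, hCpc, hpc⟩ := exists_pairCorrelation_bound B
  set Kb : ℝ := 24 + 4 * Real.exp 5 * (1 + Cpc) + 2 * Cpc with hKb
  have hKb0 : 0 ≤ Kb := by positivity
  refine ⟨B, hB, |c₁| + 8 * C₂ ^ 2 * Kb + 64 * Kb, ?_⟩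
  -- eventual conditions
  have e1 := Filter.eventually_ge_atTop (max 3 N₁)
  have e2 := (tendsto_roughLevel_two_mul' hB).eventually_ge_atTop 3
  have e3 := eventually_log_two_mul_rpow_le (B * (5 : ℕ))
  have e4 : ∀ᶠ N : ℕ in Filter.atTop, Real.log N ^ (2 * A + C₄ + 4) ≤ N := by
    have hlo := (isLittleO_log_rpow_rpow_atTop (2 * A + C₄ + 4) (by norm_num : (0 : ℝ) < 1)).bound
      (show (0 : ℝ) < 1 by norm_num)
    filter_upwards [tendsto_natCast_atTop_atTop.eventually hlo,
      Filter.eventually_gt_atTop 1] with N hN h1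
    have h1' : (1 : ℝ) < N := by exact_mod_cast h1
    rw [Real.rpow_one, one_mul, Real.norm_of_nonneg (Real.rpow_nonneg (Real.log_pos h1').le _),
      Real.norm_of_nonneg (by positivity)] at hN
    exact hN
  obtain ⟨N₀, hN₀⟩ := Filter.eventually_atTop.mp (e1.and (e2.and (e3.and e4)))
  refine ⟨N₀, fun N hN => ?_⟩
  obtain ⟨hN3', hz3, hz5, hgrow⟩ := hN₀ N hN
  have hN3 : 3 ≤ N := le_trans (le_max_left _ _) hN3'
  have hN1 : N₁ ≤ 2 * N := le_trans (le_max_right _ _) (hN3'.trans (by omega))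
  have hNr : (3 : ℝ) ≤ N := by exact_mod_cast hN3
  have hN0 : (0 : ℝ) < N := by linarith
  set z : ℝ := roughLevel B (2 * N) with hz
  set L : ℝ := Real.log N with hL
  have hz2 : 2 < z := by linarith
  have hL1 : 1 ≤ L := by
    rw [hL, ← Real.log_exp 1]
    refine Real.log_le_log (Real.exp_pos 1) ?_
    have := Real.exp_one_lt_d9
    linarith
  have hL0 : 0 < L := by linarith
  have hlog2N : Real.log ((2 * N : ℕ) : ℝ) ≤ 2 * L := by
    push_cast
    rw [Real.log_mul two_ne_zero hN0.ne', two_mul, hL]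
    have : Real.log 2 ≤ Real.log N := Real.log_le_log two_pos (by linarith)
    linarith
  have hlog2N0 : 0 ≤ Real.log ((2 * N : ℕ) : ℝ) := Real.log_natCast_nonneg _
  -- `z⁵ ≤ N`, `log z ≤ L`
  have hz5' : z ^ 5 ≤ N := by
    have e : z ^ 5 = Real.log ((2 * N : ℕ) : ℝ) ^ (B * (5 : ℕ)) := by
      rw [hz, roughLevel, ← Real.rpow_natCast, ← Real.rpow_mul hlog2N0]
    rw [e]; exact hz5
  have hz1 : 1 ≤ z := by linarith
  have hzN : z ≤ N := le_trans (by nlinarith [pow_le_pow_right₀ hz1 (by norm_num : 1 ≤ 5)]) hz5'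
  have hlogz : Real.log z ≤ L := Real.log_le_log (by linarith) hzN
  -- the weights
  have hu0 : hbWeight c N 0 = 0 := by simp [hbWeight]
  -- the sup bound `G`
  set G : ℝ := C₂ * ((2 * N : ℕ) : ℝ) * Real.log ((2 * N : ℕ) : ℝ) ^ (-(A + |C₄| + 2)) +
    (ψ ((2 * N : ℕ) : ℝ) - θ ((2 * N : ℕ) : ℝ)) with hG
  have hGbound : ∀ α : ℝ, ‖expSumOf (fun m : ℕ => (if m.Prime then Real.log (m : ℝ) else 0) - roughModel B (2 * N) m) (2 * N) α‖ ≤ G :=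
    fun α => (norm_expSumOf_thetaWeight_sub_le B N hz2 α).trans
      (add_le_add (happrox (2 * N) hN1 α) le_rfl)
  -- the fourth moment
  have hI4 : ∫ α in (0 : ℝ)..1, ‖expSumOf (hbWeight c N) N α‖ ^ 4 ≤
      c₁ * (N : ℝ) ^ 3 * L ^ C₄ := by
    have e : ∫ α in (0 : ℝ)..1, ‖expSumOf (hbWeight c N) N α‖ ^ 4 =
        ∫ α in (0 : ℝ)..1, ‖hbExpSum c N α‖ ^ 4 :=
      intervalIntegral.integral_congr fun α _ => by simp only [expSumOf_hbWeight_eq]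
    rw [e]; exact h4 N hN3
  -- `G ≤ C₂ (2N) L^{-A'} + E`, `E = ψ(2N) − θ(2N) ≤ 2√(2N) log(2N)`
  have h2N1 : (1 : ℝ) ≤ ((2 * N : ℕ) : ℝ) := by push_cast; linarith
  have hE0 : 0 ≤ ψ ((2 * N : ℕ) : ℝ) - θ ((2 * N : ℕ) : ℝ) :=
    sub_nonneg.mpr (Chebyshev.theta_le_psi _)
  have hE : ψ ((2 * N : ℕ) : ℝ) - θ ((2 * N : ℕ) : ℝ) ≤
      2 * Real.sqrt ((2 * N : ℕ) : ℝ) * Real.log ((2 * N : ℕ) : ℝ) := Chebyshev.psi_sub_theta_le h2N1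
  have hE2 : (ψ ((2 * N : ℕ) : ℝ) - θ ((2 * N : ℕ) : ℝ)) ^ 2 ≤ 32 * N * L ^ 2 := by
    have h := pow_le_pow_left₀ hE0 hE 2
    have hs : Real.sqrt ((2 * N : ℕ) : ℝ) ^ 2 = 2 * N := by
      rw [Real.sq_sqrt (by positivity)]; push_cast; ring
    calc (ψ ((2 * N : ℕ) : ℝ) - θ ((2 * N : ℕ) : ℝ)) ^ 2
        ≤ (2 * Real.sqrt ((2 * N : ℕ) : ℝ) * Real.log ((2 * N : ℕ) : ℝ)) ^ 2 := h
      _ = 4 * (2 * N) * Real.log ((2 * N : ℕ) : ℝ) ^ 2 := by rw [← hs]; ring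
      _ ≤ 4 * (2 * N) * (2 * L) ^ 2 := by
          refine mul_le_mul_of_nonneg_left (pow_le_pow_left₀ hlog2N0 hlog2N 2) (by positivity)
      _ = 32 * N * L ^ 2 := by ring
  have hGle : G ≤ C₂ * (2 * (N : ℝ)) * L ^ (-(A + |C₄| + 2)) +
      (ψ ((2 * N : ℕ) : ℝ) - θ ((2 * N : ℕ) : ℝ)) := by
    rw [hG]
    refine add_le_add ?_ le_rfl
    have h2Npos : (0 : ℝ) < ((2 * N : ℕ) : ℝ) := by positivity
    have hlog2Npos : 0 < Real.log ((2 * N : ℕ) : ℝ) :=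
      Real.log_pos (by exact_mod_cast (by omega : 1 < 2 * N))
    have hC₂0 : 0 ≤ C₂ := by
      have h := (norm_nonneg _).trans (happrox (2 * N) hN1 0)
      have hb : 0 < Real.log ((2 * N : ℕ) : ℝ) ^ (-(A + |C₄| + 2)) := Real.rpow_pos_of_pos hlog2Npos _
      by_contra hneg
      push Not at hneg
      have : C₂ * ((2 * N : ℕ) : ℝ) * Real.log ((2 * N : ℕ) : ℝ) ^ (-(A + |C₄| + 2)) < 0 :=
        mul_neg_of_neg_of_pos (mul_neg_of_neg_of_pos hneg h2Npos) hb
      linarith only [h, this]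
    have hA'le : -(A + |C₄| + 2) ≤ 0 := by linarith only [hA, abs_nonneg C₄]
    have hNle : (N : ℝ) ≤ ((2 * N : ℕ) : ℝ) := by push_cast; linarith only [hN0]
    have hpow : Real.log ((2 * N : ℕ) : ℝ) ^ (-(A + |C₄| + 2)) ≤ L ^ (-(A + |C₄| + 2)) :=
      Real.rpow_le_rpow_of_nonpos hL0 (Real.log_le_log hN0 hNle) hA'le
    have hcast : ((2 * N : ℕ) : ℝ) = 2 * (N : ℝ) := by push_cast; ring
    rw [hcast] at hpow ⊢
    exact mul_le_mul_of_nonneg_left hpow (mul_nonneg hC₂0 (by positivity))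
  have hG0 : 0 ≤ G := (norm_nonneg _).trans (hGbound 0)
  -- `∑ b² ≤ Kb N L²`
  have hSb := sum_sq_thetaWeight_sub_le hCpc hpc N hz2
  have hQ := primesProdBelow_div_totient_le_exp_mul_log hz3
  have hSb' : ∑ m ∈ range (2 * N + 1), ((if m.Prime then Real.log (m : ℝ) else 0) - roughModel B (2 * N) m) ^ 2 ≤ Kb * N * L ^ 2 := by
    refine hSb.trans ?_
    have hQ' : (roughPrimorial B (2 * N) : ℝ) / (Nat.totient (roughPrimorial B (2 * N)) : ℝ) ≤
        Real.exp 5 * L := by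
      rw [roughPrimorial]; exact hQ.trans (mul_le_mul_of_nonneg_left hlogz (Real.exp_pos 5).le)
    have hL2 : L ≤ L ^ 2 := by nlinarith only [hL1]
    have hNL2 : (N : ℝ) ≤ N * L ^ 2 := le_mul_of_one_le_right hN0.le (one_le_pow₀ hL1)
    have ha : ((2 * N + 1 : ℕ) : ℝ) * Real.log ((2 * N : ℕ) : ℝ) ^ 2 ≤ 12 * (N * L ^ 2) := by
      have h1 : ((2 * N + 1 : ℕ) : ℝ) ≤ 3 * N := by push_cast; linarith only [hNr]
      calc ((2 * N + 1 : ℕ) : ℝ) * Real.log ((2 * N : ℕ) : ℝ) ^ 2 ≤ (3 * N) * (2 * L) ^ 2 :=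
            mul_le_mul h1 (pow_le_pow_left₀ hlog2N0 hlog2N 2) (sq_nonneg _) (by positivity)
        _ = 12 * (N * L ^ 2) := by ring
    have hb1 : ((2 * N : ℕ) : ℝ) * ((roughPrimorial B (2 * N) : ℝ) /
        (Nat.totient (roughPrimorial B (2 * N)) : ℝ)) * (1 + Cpc) ≤
        2 * Real.exp 5 * (1 + Cpc) * (N * L ^ 2) := by
      have h1 : ((2 * N : ℕ) : ℝ) * ((roughPrimorial B (2 * N) : ℝ) /
          (Nat.totient (roughPrimorial B (2 * N)) : ℝ)) ≤ 2 * N * (Real.exp 5 * L) := by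
        push_cast; exact mul_le_mul_of_nonneg_left hQ' (by positivity)
      have h2 : 2 * (N : ℝ) * (Real.exp 5 * L) ≤ 2 * Real.exp 5 * (N * L ^ 2) := by
        have := mul_le_mul_of_nonneg_left hL2 (mul_nonneg hN0.le (Real.exp_pos 5).le)
        linarith only [this]
      have h12 := mul_le_mul_of_nonneg_right (h1.trans h2) (show (0 : ℝ) ≤ 1 + Cpc by positivity)
      linarith only [h12]
    have hb2 : Cpc * z ^ 5 ≤ Cpc * (N * L ^ 2) := mul_le_mul_of_nonneg_left (hz5'.trans hNL2) hCpc.le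
    rw [hKb]
    linarith only [ha, hb1, hb2, hN0, hCpc]
  have hSb0 : 0 ≤ ∑ m ∈ range (2 * N + 1), ((if m.Prime then Real.log (m : ℝ) else 0) - roughModel B (2 * N) m) ^ 2 :=
    sum_nonneg fun m _ => sq_nonneg _
  -- Parseval / majorant and the conclusion
  have step1 := sum_Ioc_sq_le (u := hbWeight c N)
    (b := fun m : ℕ => (if m.Prime then Real.log (m : ℝ) else 0) - roughModel B (2 * N) m) (N := N) hu0
  have hlam : 0 < Real.sqrt (L ^ (-(A + C₄))) := Real.sqrt_pos.mpr (Real.rpow_pos_of_pos hL0 _)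
  have step2 := sum_conv_sq_le (f := hbWeight c N) (N := N) hGbound hlam
  rw [Real.sq_sqrt (Real.rpow_pos_of_pos hL0 _).le, inv_pow,
    Real.sq_sqrt (Real.rpow_pos_of_pos hL0 _).le] at step2
  exact step1.trans (fourier_final hL1 hN0 step2 hI4 hG0 hGle hE2 hSb0 hSb' hKb0 hA hgrow)

end Literature.NumberTheory.Sieve.CubicMinorant

end
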